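import Literature.AlgebraicGeometry.AbelianSchemes.SerreTateCanonicalLift
import Literature.AlgebraicGeometry.AbelianSchemes.HomDescentMulNOfNeZero
import Literature.AlgebraicGeometry.AbelianSchemes.AbelianSchemeLiftRigidity
import Literature.AlgebraicGeometry.GroupSchemes.ReductionKernelKilledByNSquare
import Literature.AlgebraicGeometry.GroupSchemes.BarsottiTateGroupBaseChange
import Literature.AlgebraicGeometry.GroupSchemes.BarsottiTateGroupHom
import HarnessLib

/-!
# The Serre–Tate theorem on HOMOMORPHISMS: a homomorphism of abelian schemes lifts along a square-zero thickening of an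
# Artinian local base with `p` nilpotent iff it lifts on `p`-divisible groups, and then uniquely ([Katz1981SerreTate] Thm. 1.2.1)

Layer `Literature/AlgebraicGeometry/AbelianSchemes`, namespace `Literature.AlgebraicGeometry.AbelianSchemes.SerreTate`.
THEOREMS ONLY (no definition, no named fact, no instance, no notation, no `sorry`).

THE PRINT.  [Katz1981SerreTate] Thm. 1.2.1 (Serre–Tate; Drinfeld's proof): for `R` a ring in which the prime `p` is nilpotent and
`I ⊂ R` a nilpotent ideal, `R₀ = R/I`, the functor `A ↦ (A₀, A[p^∞], ε)` from abelian schemes over `R` to triples (abelian scheme over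
`R₀`, `p`-divisible group over `R`, identification over `R₀`) is an equivalence.  FULL FAITHFULNESS (proof p. 142, from Lemma 1.1.3:
«both abelian schemes and `p`-divisible groups satisfy all the hypotheses of 1.1.3»): a homomorphism `f₀ : X₀ → Y₀` lifts to
`f : X → Y` iff `f₀[p^∞]` lifts to `X[p^∞] → Y[p^∞]`, and then `f` is unique with `f[p^∞]` the given lift.

THIS FILE proves it in SCHEME currency along a SQUARE-ZERO thickening `Spec (A⧸J) ↪ Spec A` (`A` Artinian local, `p` nilpotent in
`A`, `J ≠ ⊤`, `𝔪_A · J = 0` — the small extensions of the deformation-theoretic use, [RapoportSmithlingZhang2020Diagonal] Thm. 4.1),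
with Barsotti–Tate groups in Tate's form (★ `GroupSchemes.BTGroup`, `BTGroup.Hom`, `BTGroup.IsBaseChangeVia`) presented as kernels
`iX n : BX.G n ↪ X` (`B = X[p^∞]`):

* **`exists_hom_lift_of_btHom`** — DATA: abelian `X, Y ∕ Spec A` with `p`-divisible groups `iX, iY`; abelian `X₀, Y₀ ∕ Spec (A⧸J)`
  with `iX₀, iY₀`; base-change squares `GX, GY` of group schemes and `cX, cY` of the layers, compatible (`iX₀ n ≫ GX = cX n ≫ iX n`);
  a homomorphism `f₀ : X₀ → Y₀` with `α₀ = f₀[p^∞]`; a homomorphism of Barsotti–Tate groups `φ : BX → BY` LIFTING `α₀`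
  (`cX n ≫ φ n = α₀ n ≫ cY n`).  THEN: `∃ f : X → Y` homomorphism, `f₀ ≫ GY = GX ≫ f`, `iX n ≫ f = φ n ≫ iY n` for all `n`, and
  `f` is the ONLY homomorphism lifting `f₀` — the text of `stub_L4B1ff_serreTateHomLift` of `Cruxes/HLiu418/Lines/F0_P6b_BTSerreTate.lean`
  with its local predicate `IsTorsionTower` unfolded.

PROOF (Katz 1.1.3 with `N = p^m`, `(p : A)^m = 0`, `ν = 1` since `J² ⊆ 𝔪J = 0`): the Katz hypothesis «`N` kills the kernel of
reduction of `Y`» is ★ `ReductionKernel.pow_eq_one_of_isPullback` (`N · 1_A = 0`); ★ `SerreTate.exists_powLift` gives the homomorphism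
`Nf : X → Y` with the EVALUATION RULE; at the layer `BX.G n` the point `φ n ≫ iY n` lifts `f₀ ∘ iX₀ n`, so `iX n ≫ Nf = (φ n ≫ iY n)^N`;
at `n = m` this is `1` (`BY.G m` is killed by `p^m`), so `Nf` kills `X[N]` and `Nf = [N] ≫ f` for a unique homomorphism `f` (★
`exists_isMonHom_pow_id_comp_eq_of_forall_pow_eq_one_of_ne_zero`, `N ≠ 0`, any base); `f` lifts `f₀` because `[N]_{X₀}` is an
epimorphism; `iX n ≫ f = φ n ≫ iY n` after the epimorphism `[p^m] : BX.G (n+m) → BX.G n` (iterated `pMap`, faithfully flat);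
uniqueness is rigidity on the one closed fibre (★ `LiftedLaw.comp_eq_toUnit_comp_of_compatible`, [MumfordFogartyKirwan1994] Prop. 6.1).

Cell hodgecm-mathlib (D-0151 ∕ D-0183 FLOOR 0), P6 Row 4B (Serre–Tate), organ (O4) = the CLOSER of `stub_L4B1ff_serreTateHomLift`
(F0P6-p12 (g0), twin σ2 SCHEME-THEORETIC); generic, count-neutral capital on `--supports stmt-HodgeConjecture-24832`.  HC_CM is proved
only modulo the printed citations until rung 0 closes; nothing here is about HC.

## References
* [Katz1981SerreTate] N. M. Katz, *Serre–Tate local moduli*, LNM 868 (1981), exp. Vbis, §1.1 Lemma 1.1.3, §1.2 Thm. 1.2.1 and its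
  proof (pp. 138–143).
* [Tate1967] J. T. Tate, *p-divisible groups*, Proc. Conf. Local Fields (Driebergen 1966), Springer (1967), §2 (2.1).
* [MumfordFogartyKirwan1994] D. Mumford, J. Fogarty, F. Kirwan, *Geometric Invariant Theory*, 3rd ed. (1994), Ch. 6 §1 Prop. 6.1,
  Cor. 6.4 (pp. 115–117); Ch. 6 §2 Lemma 6.12 (p. 122).
* [RapoportSmithlingZhang2020Diagonal] M. Rapoport, B. Smithling, W. Zhang, *Arithmetic diagonal cycles on unitary Shimura varieties*,
  Compos. Math. 156 (2020), §4.1 Thm. 4.1 (p. 17) — the consumer.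
-/

set_option backward.isDefEq.respectTransparency false

noncomputable section

open CategoryTheory CategoryTheory.Limits AlgebraicGeometry MonoidalCategory CartesianMonoidalCategory IsLocalRing
open scoped MonObj

universe u

namespace Literature.AlgebraicGeometry.AbelianSchemes.SerreTate

open Literature.AlgebraicGeometry.GroupSchemes

/-- **THE SERRE–TATE THEOREM ON HOMOMORPHISMS** ([Katz1981SerreTate] Thm. 1.2.1, full faithfulness, with Lemma 1.1.3 (1)–(4); scheme
form along a square-zero thickening).  `p` prime, nilpotent in the Artinian local ring `A`; `J ≠ ⊤`, `𝔪_A · J = 0`; `i : Spec (A⧸J) ↪ Spec A`.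
DATA over `A`: abelian schemes `X, Y` with `p`-divisible groups `BX, BY` presented as kernels `iX n : BX.G n ↪ X`, `iY` (homomorphisms,
cartesian against `[p^n]`, compatible with the transitions); over `A⧸J`: `X₀, Y₀` with `iX₀`, `iY₀`; base-change squares of group schemes
`GX : X₀ → X`, `GY : Y₀ → Y` over `i` and of the layers `cX`, `cY` (★ `IsBaseChangeVia`) with `iX₀ n ≫ GX = cX n ≫ iX n`,
`iY₀ n ≫ GY = cY n ≫ iY n`; a homomorphism `f₀ : X₀ → Y₀` with induced `α₀ : BX₀ → BY₀` (`α₀ n ≫ iY₀ n = iX₀ n ≫ f₀`); a homomorphism of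
Barsotti–Tate groups `φ : BX → BY` lifting `α₀` (`cX n ≫ φ n = α₀ n ≫ cY n`).  THEN `f₀` lifts to a UNIQUE homomorphism `f : X → Y`
(`f₀ ≫ GY = GX ≫ f`), and `f[p^∞] = φ` (`iX n ≫ f = φ n ≫ iY n`).  Proof: Katz 1.1.3 with `N = p^m` — ★ `ReductionKernel.pow_eq_one_of_isPullback`
(the Katz hypothesis), ★ `SerreTate.exists_powLift` (`N·f` and its evaluation rule), ★ `exists_isMonHom_pow_id_comp_eq_of_forall_pow_eq_one_of_ne_zero`
(division by `[N]`), ★ `LiftedLaw.comp_eq_toUnit_comp_of_compatible` (rigidity). [cite: Katz1981SerreTate, §1.2 Thm. 1.2.1 and §1.1 Lemma 1.1.3 (pp. 138–143)]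
[cite: Tate1967, §2 (2.1)] [cite: MumfordFogartyKirwan1994, Ch. 6 §1 Prop. 6.1 and Cor. 6.4 (pp. 115–117)] -/
theorem exists_hom_lift_of_btHom (p : ℕ) (hp : p.Prime) {A : Type u} [CommRing A] [IsArtinianRing A] [IsLocalRing A]
    (hpA : IsNilpotent (p : A)) (J : Ideal A) (hJ : J ≠ ⊤) (hmJ : maximalIdeal A * J = ⊥)
    (X Y : AbelianSchemeOver (Spec (.of A))) {hX hY : ℕ}
    (BX : BTGroup (Spec (.of A)) p hX) (iX : ∀ n, BX.G n ⟶ X.X) (hiXm : ∀ n, letI := BX.grpObj n; IsMonHom (iX n))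
    (hiXp : ∀ n, IsPullback (iX n) (toUnit (BX.G n)) (((𝟙 X.X : X.X ⟶ X.X) ^ (p ^ n) : X.X ⟶ X.X)) η[X.X])
    (hiXi : ∀ n, BX.incl n ≫ iX (n + 1) = iX n)
    (BY : BTGroup (Spec (.of A)) p hY) (iY : ∀ n, BY.G n ⟶ Y.X) (hiYm : ∀ n, letI := BY.grpObj n; IsMonHom (iY n))
    (hiYp : ∀ n, IsPullback (iY n) (toUnit (BY.G n)) (((𝟙 Y.X : Y.X ⟶ Y.X) ^ (p ^ n) : Y.X ⟶ Y.X)) η[Y.X])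
    (hiYi : ∀ n, BY.incl n ≫ iY (n + 1) = iY n)
    (X₀ Y₀ : AbelianSchemeOver (Spec (.of (A ⧸ J))))
    (BX₀ : BTGroup (Spec (.of (A ⧸ J))) p hX) (iX₀ : ∀ n, BX₀.G n ⟶ X₀.X)
    (BY₀ : BTGroup (Spec (.of (A ⧸ J))) p hY) (iY₀ : ∀ n, BY₀.G n ⟶ Y₀.X)
    (GX : X₀.X.left ⟶ X.X.left) (hGX : X₀.IsBaseChangeVia X (Spec.map (CommRingCat.ofHom (Ideal.Quotient.mk J))) GX)
    (cX : ∀ n, (BX₀.G n).left ⟶ (BX.G n).left)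
    (hcX : BX₀.IsBaseChangeVia BX (Spec.map (CommRingCat.ofHom (Ideal.Quotient.mk J))) cX)
    (hcompX : ∀ n, (iX₀ n).left ≫ GX = cX n ≫ (iX n).left)
    (GY : Y₀.X.left ⟶ Y.X.left) (hGY : Y₀.IsBaseChangeVia Y (Spec.map (CommRingCat.ofHom (Ideal.Quotient.mk J))) GY)
    (cY : ∀ n, (BY₀.G n).left ⟶ (BY.G n).left)
    (hcompY : ∀ n, (iY₀ n).left ≫ GY = cY n ≫ (iY n).left)
    (f₀ : X₀.X ⟶ Y₀.X) (hf₀ : IsMonHom f₀)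
    (α₀ : BTGroup.Hom BX₀ BY₀) (hα₀ : ∀ n, α₀.app n ≫ iY₀ n = iX₀ n ≫ f₀)
    (φ : BTGroup.Hom BX BY) (hφ : ∀ n, cX n ≫ (φ.app n).left = (α₀.app n).left ≫ cY n) :
    ∃ f : X.X ⟶ Y.X, IsMonHom f ∧ f₀.left ≫ GY = GX ≫ f.left ∧ (∀ n, iX n ≫ f = φ.app n ≫ iY n) ∧
      ∀ f' : X.X ⟶ Y.X, IsMonHom f' → f₀.left ≫ GY = GX ≫ f'.left → f' = f := by
  haveI := hf₀
  letI : ∀ n, GrpObj (BX.G n) := BX.grpObj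
  letI : ∀ n, GrpObj (BY.G n) := BY.grpObj
  haveI : ∀ n, IsMonHom (iX n) := hiXm
  haveI : ∀ n, IsMonHom (iY n) := hiYm
  haveI : ∀ n, IsMonHom (φ.app n) := φ.isMonHom_app
  haveI : IsCommMonObj X.X := X.isCommMonObj_of_isLocallyNoetherian_base
  haveI : IsCommMonObj Y.X := Y.isCommMonObj_of_isLocallyNoetherian_base
  set i := Spec.map (CommRingCat.ofHom (Ideal.Quotient.mk J)) with hi
  have hPX : IsPullback GX X₀.X.hom X.X.hom i := hGX.snd.1
  -- `N = p^m` with `(p : A)^m = 0`; `J² = 0`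
  obtain ⟨m, hm⟩ := hpA
  have hN0 : p ^ m ≠ 0 := pow_ne_zero m hp.ne_zero
  have hJJ : J * J = ⊥ :=
    le_bot_iff.mp (hmJ ▸ Ideal.mul_mono_left (IsLocalRing.le_maximalIdeal hJ))
  have hNJ : ∀ a ∈ J, ((p ^ m : ℕ) : A) * a = 0 := fun a _ => by rw [Nat.cast_pow, hm, zero_mul]
  -- the Katz hypothesis for `Y` (Lemma 1.1.2, ★ `ReductionKernel.pow_eq_one_of_isPullback`) and the canonical lift `N·f` (Lemma 1.1.3 (3))
  have hK : ∀ ⦃W : Over (Spec (.of A))⦄ ⦃W₀ : Scheme.{u}⦄ (ρ : W₀ ⟶ W.left) (b : W₀ ⟶ Spec (.of (A ⧸ J))),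
      IsPullback ρ b W.hom (Spec.map (CommRingCat.ofHom (Ideal.Quotient.mk J))) →
      ∀ q : W ⟶ Y.X, ρ ≫ q.left = ρ ≫ (1 : W ⟶ Y.X).left → q ^ (p ^ m) = 1 :=
    fun W W₀ ρ b hρ q hq => ReductionKernel.pow_eq_one_of_isPullback hJJ hNJ ρ b hρ q hq
  obtain ⟨Nf, hNfhom, hNfres, heval⟩ := exists_powLift (N := p ^ m) hJJ hGX hGY f₀ hK
  haveI := hNfhom
  -- EVALUATION AT THE LAYERS: `iX n ≫ Nf = (φ n ≫ iY n)^N`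
  have hlayer : ∀ n, iX n ≫ Nf = (φ.app n ≫ iY n) ^ (p ^ m) := fun n => by
    obtain ⟨w, hP, -, -⟩ := hcX.1 n
    refine heval (cX n) (BX₀.G n).hom hP (iX n) (φ.app n ≫ iY n) (iX₀ n).left (hcompX n) (Over.w (iX₀ n)) ?_
    rw [Over.comp_left, ← Category.assoc, hφ n, Category.assoc, ← hcompY n, ← Category.assoc, ← Over.comp_left, hα₀ n,
      Over.comp_left, Category.assoc]
  -- `Nf` kills the `N`-torsion
  have hkill : ∀ ⦃T : Over (Spec (.of A))⦄ (t : T ⟶ X.X), t ^ (p ^ m) = 1 → t ≫ Nf = 1 := by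
    intro T t ht
    have wt : t ≫ ((𝟙 X.X : X.X ⟶ X.X) ^ (p ^ m)) = toUnit T ≫ η[X.X] := by
      rw [MonObj.comp_pow, Category.comp_id, ht, Hom.one_def]
    have hs : (hiXp m).lift t (toUnit T) wt ≫ iX m = t := (hiXp m).lift_fst _ _ wt
    have hYm : iY m ^ (p ^ m) = 1 := by
      rw [← Category.comp_id (iY m), ← MonObj.comp_pow, (hiYp m).w]
      exact Hom.one_def.symm
    rw [← hs, Category.assoc, hlayer m, MonObj.comp_pow, ← Category.assoc, ← MonObj.comp_pow, hYm, MonObj.comp_one]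
  -- division by `[N]` (Lemma 1.1.3 (4), ★ `HomDescentMulNOfNeZero`)
  obtain ⟨f, hf, hfN, -⟩ := X.exists_isMonHom_pow_id_comp_eq_of_forall_pow_eq_one_of_ne_zero Nf hN0 hkill
  haveI := hf
  -- `f` lifts `f₀`: test after the epimorphism `[N]_{X₀}`
  have hfGX : f₀.left ≫ GY = GX ≫ f.left := by
    set E : X₀.X.left ⟶ X₀.X.left := (((𝟙 X₀.X : X₀.X ⟶ X₀.X) ^ (p ^ m)) : X₀.X ⟶ X₀.X).left with hE
    haveI := X₀.flat_pow_id_left_of_ne_zero hN0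
    haveI := X₀.surjective_pow_id_left_of_ne_zero hN0
    haveI : Epi E := Flat.epi_of_flat_of_surjective _
    have eN : (f₀ ^ (p ^ m)).left = E ≫ f₀.left := by
      rw [hE, ← Over.comp_left, MonObj.pow_comp, Category.id_comp]
    rw [← cancel_epi E]
    calc E ≫ f₀.left ≫ GY = (f₀ ^ (p ^ m)).left ≫ GY := by rw [eN, Category.assoc]
      _ = GX ≫ Nf.left := hNfres.symm
      _ = GX ≫ (((𝟙 X.X : X.X ⟶ X.X) ^ (p ^ m)) ≫ f).left := by rw [hfN]
      _ = (GX ≫ (((𝟙 X.X : X.X ⟶ X.X) ^ (p ^ m)) : X.X ⟶ X.X).left) ≫ f.left := by rw [Over.comp_left, Category.assoc]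
      _ = E ≫ GX ≫ f.left := by rw [hE, ← hGX.pow_id_left_comp, Category.assoc]
  refine ⟨f, hf, hfGX, ?_, ?_⟩
  · -- `f[p^∞] = φ`: test after the epimorphism `[p^m] : BX.G (n + m) → BX.G n`
    intro n
    -- the iterated `pMap`s of `BX`, `BY` (Tate: `0 → G_m → G_{n+m} → G_n → 0`)
    have key : ∀ k : ℕ, ∃ (π : BX.G (n + k) ⟶ BX.G n) (π' : BY.G (n + k) ⟶ BY.G n), Epi π ∧
        π ≫ iX n = iX (n + k) ^ (p ^ k) ∧ π' ≫ iY n = iY (n + k) ^ (p ^ k) ∧ π ≫ φ.app n = φ.app (n + k) ≫ π' := by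
      intro k
      induction k with
      | zero => exact ⟨𝟙 _, 𝟙 _, inferInstance, by simp, by simp, by simp⟩
      | succ k ih =>
        obtain ⟨π, π', hπ, hπX, hπY, hπφ⟩ := ih
        haveI := BX.flat_pMap (n + k)
        haveI := BX.surjective_pMap (n + k)
        haveI : Epi (BX.pMap (n + k)).left := Flat.epi_of_flat_of_surjective _
        haveI : Epi (BX.pMap (n + k)) := Over.epi_of_epi_left _
        refine ⟨BX.pMap (n + k) ≫ π, BY.pMap (n + k) ≫ π', epi_comp _ _, ?_, ?_, ?_⟩
        · show (BX.pMap (n + k) ≫ π) ≫ iX n = iX (n + k + 1) ^ p ^ (k + 1)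
          rw [Category.assoc, hπX, MonObj.comp_pow, ← hiXi (n + k), ← Category.assoc, BX.pMap_incl, MonObj.pow_comp,
            ← pow_mul, ← pow_succ']
          simp only [Category.id_comp]
        · show (BY.pMap (n + k) ≫ π') ≫ iY n = iY (n + k + 1) ^ p ^ (k + 1)
          rw [Category.assoc, hπY, MonObj.comp_pow, ← hiYi (n + k), ← Category.assoc, BY.pMap_incl, MonObj.pow_comp,
            ← pow_mul, ← pow_succ']
          simp only [Category.id_comp]
        · show (BX.pMap (n + k) ≫ π) ≫ φ.app n = φ.app (n + k + 1) ≫ BY.pMap (n + k) ≫ π'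
          rw [Category.assoc, hπφ, ← Category.assoc, φ.pMap_comp_app, Category.assoc]
    obtain ⟨π, π', hπ, hπX, hπY, hπφ⟩ := key m
    rw [← cancel_epi π, ← Category.assoc, hπX, ← Category.assoc, hπφ, Category.assoc, hπY, MonObj.comp_pow,
      ← hlayer (n + m), ← hfN, ← Category.assoc, MonObj.comp_pow, Category.comp_id]
  · -- uniqueness: rigidity on the closed fibre ([MumfordFogartyKirwan1994] Prop. 6.1, ★ `LiftedLaw.comp_eq_toUnit_comp_of_compatible`)
    intro f' hf' hf'₀
    haveI := hf'
    haveI : IsProper X.X.hom := X.isProper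
    haveI : Smooth X.X.hom := X.isSmooth
    haveI : IsProper Y.X.hom := Y.isProper
    let κ : Over.mk (X₀.X.hom ≫ i) ⟶ X.X := Over.homMk GX hPX.w
    have hκ : κ ≫ f' = κ ≫ f := Over.OverMorphism.ext (hf'₀.symm.trans hfGX)
    have hu : (toUnit X₀.X ≫ η[Y₀.X]).left ≫ GY = GX ≫ (f' / f).left := by
      have h1 : κ ≫ (f' / f) = 1 := by rw [GrpObj.comp_div, hκ, div_self']
      have h2 : (toUnit X₀.X ≫ η[Y₀.X]) = 1 := Hom.one_def.symm
      have e1 : (toUnit X₀.X ≫ η[Y₀.X]).left ≫ GY = (1 : Over.mk (X₀.X.hom ≫ i) ⟶ Y.X).left := by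
        rw [h2, ← hGY.pushHom_one, AbelianSchemeOver.IsBaseChangeVia.pushHom_left]
      have e2 : GX ≫ (f' / f).left = (κ ≫ (f' / f)).left := rfl
      rw [e1, e2, h1]
    have key := AbelianSchemeOver.LiftedLaw.comp_eq_toUnit_comp_of_compatible hJ X₀ X.X hPX Y.X GY (f' / f) η[Y₀.X] hu
      η[X.X] (𝟙 X.X)
    rw [Category.id_comp, GrpObj.comp_div, IsMonHom.one_hom, IsMonHom.one_hom, div_self', MonObj.comp_one] at key
    exact div_eq_one.mp key

end Literature.AlgebraicGeometry.AbelianSchemes.SerreTate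

end
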